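import Summits.ValiantsHypothesis.ValiantsHypothesis.Theorems.SuccinctLiftSmlAnyField
import Summits.ValiantsHypothesis.ValiantsHypothesis.Theorems.SuccinctLiftTwoNonUnit
import Summits.ValiantsHypothesis.ValiantsHypothesis.Theorems.DefinabilityGapK1DepthLadder
import Literature.Computability.AlgebraicComplexity.IMMCompleteness

/-!
# SuccinctLift — the DETERMINANT over ANY field at growing product depth `σ·log₂log₂log₂ n`, `σ < 1/2`

Support file for wall D of `route-ValiantsHypothesis-SuccinctLift` (stmt-ValiantsHypothesis-23721).
Census cell W34 «2-non-unit cut» (`SuccinctLiftTwoNonUnit`): `AlgDescentLog3 ⟺ D_int(2,Δ₁) ∧ D_den(2,Δ₁)`,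
and the VP-internal LEAF `¬ DetEasyOver 𝔽̄₂ Δ` implies `D_int(2, Δ)`
(`nonUnitHardAt_two_of_not_detEasyOver_algClosure`).  The floor of the leaf over the PRIME field
`𝔽₂` is decided at slope `1` (`not_detEasyOver_zmod_two_log3`, Razborov–Smolensky); over `𝔽̄₂` the
Boolean shadow is useless and only algebraic lower bounds VALID IN CHARACTERISTIC `2` can bite.
This file lands the strongest such bound in print — Forbes (CCC 2024): the Limaye–Srinivasan–Tavenas
bounds hold over every field — in the kernel and in the leaf's own currency: for EVERY field `K`
and every slope `p/q < 1/2`,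
`¬ DetEasyOver K (fun n => p * ⌊log₂⌊log₂⌊log₂ n⌋⌋⌋ / q + K₀)` (`not_detEasyOver_anyField`),
whence the leaf and `D_int(2, ·)` at every such budget (`nonUnitHardAt_two_of_lt`): the slope axis
of the `𝔽̄₂` leaf is DECIDED on `[0, 1/2)` and OPEN on `[1/2, 1]` (route budget: slope `1`, `+1`).
Chain: `SuccinctLiftSmlAnyField.immHard_anyField` (IMM, general circuits, any field, `σ < 1/2`)
→ `IMM_{m,⌊√log₂ m⌋}` is a p-projection of `(det_n)` over any commutative ring
(`isPProjection_detPoly_of_isVPwsFamily`, `VBP`-completeness of `det`) → padding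
`det_m ≤_proj det_{m'}` (`isProjection_detPoly_of_le`) → the tower bookkeeping of
`DefinabilityGapK1DepthLadder.perHard_io_log3` (`m = 2^2^2^Y`, depth slack `p + 1`).
Finally the PERMANENT over EVERY field at the same budgets (`not_perEasyOver_anyField`:
characteristic `2` through `per = det`, characteristic `≠ 2` through the `VNP`-completeness of `per`
over `K`), whence `D_int(r, ⌊σ L₃⌋ + K₀)` for EVERY prime `r` and every `σ < 1/2`
(`nonUnitHardAt_of_lt`).

References: Forbes2024LowDepth (CCC 2024, Thm. 1, Cor. 2); LimayeSrinivasanTavenas2025 (Cor. 4);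
Burgisser2024Completeness (Thm. 2.20: `det` is `VBP`-complete over any field); Burgisser2000
(Ch. 2); Valiant1979.
-/

noncomputable section

open MvPolynomial

-- the summit and the problem share the name `ValiantsHypothesis` (D-0017 single-conjunct layout)
set_option linter.dupNamespace false

namespace Summit.ValiantsHypothesis.ValiantsHypothesis.Theorems.SuccinctLiftSmlAnyFieldDet

open Literature.Computability.AlgebraicComplexity ArithCircuit
open SuccinctLiftSmlAnyField SuccinctLiftTwoNonUnit DepthWindow DefinabilityGapK1DepthLadder

universe u

/-! ### Padding the determinant: `det_m` is a projection of `det_{m'}`, `m ≤ m'` -/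

/-- **The block identity** `det_{m'}(X 0; 0 I) = det_m(X)`. [cite: Burgisser2000, Def. 2.6] -/
theorem aeval_padSubst_detPoly (k : Type u) [CommRing k] {m m' : ℕ} (h : m ≤ m') :
    aeval (padSubst k h) (detPoly (Fin m') k) = detPoly (Fin m) k := by
  have h1 : aeval (padSubst k h) (detPoly (Fin m') k) =
      (Matrix.of fun i j : Fin m' => padSubst k h (i, j)).det := by
    unfold detPoly
    rw [AlgHom.map_det]
    congr 1
    ext i j
    simp [AlgHom.mapMatrix_apply, Matrix.map_apply, Matrix.mvPolynomialX_apply]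
  rw [h1, of_padSubst_eq, Matrix.det_submatrix_equiv_self, Matrix.det_fromBlocks_zero₂₁,
    Matrix.det_one, mul_one]
  rfl

/-- **`det_m` is a projection of `det_{m'}`** for `m ≤ m'`, over any commutative ring.
[cite: Burgisser2000, Def. 2.6] -/
theorem isProjection_detPoly_of_le (k : Type u) [CommRing k] {m m' : ℕ} (h : m ≤ m') :
    IsProjection (detPoly (Fin m) k) (detPoly (Fin m') k) :=
  ⟨padSubst k h, padSubst_isVarOrConst k h, (aeval_padSubst_detPoly k h).symm⟩

/-! ### Circuit transport along a projection, over any commutative semiring -/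

/-- **Circuit transport along a projection** (same product-depth, no more wires, few gates), the
ring-generic reading of `DepthWindow.exists_circuit_of_isProjection`. [cite: Burgisser2000TCS, §2] -/
theorem exists_circuit_of_isProjectionK {k : Type u} [CommSemiring k] {σ τ : Type*}
    {g : MvPolynomial τ k} {f : MvPolynomial σ k}
    (h : IsProjection g f) (C : ArithCircuit k σ) (hC : C.Computes f) :
    ∃ D : ArithCircuit k τ, D.Computes g ∧ D.productDepth ≤ C.productDepth ∧
      D.edgeSize ≤ C.edgeSize ∧ D.size ≤ C.edgeSize := by
  obtain ⟨s, hs⟩ := exists_substVCFun_of_isProjection h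
  obtain ⟨D, hDe, hDd, hDw, hDs⟩ := exists_size_le_edgeSize (C.substVC s)
  refine ⟨D, ?_, ?_, ?_, hDs.trans ?_⟩
  · rw [Computes, hDe, eval_substVC, hs]
    rw [Computes] at hC
    rw [hC]
  · rw [productDepth_substVC] at hDd; exact hDd
  · rw [edgeSize_substVC] at hDw; exact hDw
  · rw [edgeSize_substVC] at hDw; exact hDw

/-! ### `(IMM_{m,⌊√log₂ m⌋})_m ∈ VBP` over any commutative ring -/

/-- The family `m ↦ IMM_{m,⌊√⌊log₂ m⌋⌋}` is in `VP_ws = VBP` over any commutative ring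
(`IMMSkew.wsComplexity_immPoly_le`, monotone in `d ≤ m`). [cite: Burgisser2024Completeness, Rem. 2.8(2)] -/
theorem isVPwsFamily_immPoly_sqrtLog (k : Type u) [CommRing k] :
    IsVPwsFamily fun m => immPoly m (Nat.sqrt (Nat.log 2 m)) k := by
  have hid : IsPBounded fun n : ℕ => n := IsPBounded.id
  have hB : IsPBounded fun n : ℕ =>
      n * (4 * ((n + 2) * (2 * ((n + 1) * n) + 3) ^ 2)) + (n + 1) :=
    IsPBounded.add_holds (IsPBounded.mul_holds hid (IsPBounded.mul_holds (IsPBounded.const 4)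
      (IsPBounded.mul_holds (IsPBounded.add_holds hid (IsPBounded.const 2))
        (IsPBounded.pow_holds (IsPBounded.add_holds (IsPBounded.mul_holds (IsPBounded.const 2)
          (IsPBounded.mul_holds (IsPBounded.add_holds hid (IsPBounded.const 1)) hid))
          (IsPBounded.const 3)) 2))))
      (IsPBounded.add_holds hid (IsPBounded.const 1))
  refine hB.mono fun m => (IMMSkew.wsComplexity_immPoly_le k m (Nat.sqrt (Nat.log 2 m))).trans ?_
  have hd : Nat.sqrt (Nat.log 2 m) ≤ m := (Nat.sqrt_le_self _).trans (Nat.log_le_self 2 m)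
  gcongr

/-! ### The determinant over any field -/

/-- **The determinant is hard at product depth `⌊σ·log₂log₂log₂ n⌋ + K₀` over EVERY field, for every
`σ = p/q < 1/2`** (Forbes 2024 + `VBP`-completeness of `det`, in the kernel): there is no `c` such
that for every `n` some circuit over `K` of product depth `≤ ⌊p ⌊log₂⌊log₂⌊log₂ n⌋⌋⌋/q⌋ + K₀` and
`≤ n^c + c` wires computes `det_n`.  At a tower `m = 2^2^2^Y`, `IMM_{m,⌊√log₂ m⌋}` is a projection of
`det_{t' m}`, `t' m = max (t m) m ≤ m^{a+1} + a + 1`, `L₃(t' m) ≤ Y + 1`, so a cheap circuit for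
`det_{t' m}` would give a cheap one for `IMM` at slope `< 1/2`, against `immHard_anyField`.
[cite: Forbes2024LowDepth, Thm. 1, Cor. 2] [cite: Burgisser2024Completeness, Thm. 2.20]
[cite: LimayeSrinivasanTavenas2025, Cor. 4] -/
theorem not_detEasyOver_anyField (K : Type) [Field K] {p q : ℕ} (hpq : 2 * p < q) (K₀ : ℕ) :
    ¬ DetEasyOver K (fun n => p * Nat.log 2 (Nat.log 2 (Nat.log 2 n)) / q + K₀) := by
  classical
  rintro ⟨c, hC⟩
  obtain ⟨t, ⟨a, ha⟩, hproj⟩ :=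
    isPProjection_detPoly_of_isVPwsFamily (isVPwsFamily_immPoly_sqrtLog K)
  -- the padded index `t' m = max (t m) m`
  obtain ⟨t', ht'⟩ : ∃ t' : ℕ → ℕ, ∀ m, t' m = max (t m) m := ⟨_, fun _ => rfl⟩
  have ht'le : ∀ m, t' m ≤ m ^ (a + 1) + (a + 1) := fun m => by
    rw [ht']
    refine max_le ((ha m).trans ?_) ?_
    · rcases Nat.eq_zero_or_pos m with rfl | hm
      · rcases Nat.eq_zero_or_pos a with rfl | hapos
        · simp
        · rw [zero_pow hapos.ne', zero_pow (by omega)]; omega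
      · exact Nat.add_le_add (Nat.pow_le_pow_right hm (Nat.le_succ a)) (Nat.le_succ a)
    · calc m = m ^ 1 := (pow_one m).symm
        _ ≤ m ^ (a + 1) := by
            rcases Nat.eq_zero_or_pos m with rfl | hm
            · simp
            · exact Nat.pow_le_pow_right hm (by omega)
        _ ≤ m ^ (a + 1) + (a + 1) := Nat.le_add_right _ _
  obtain ⟨b, hb⟩ : IsPBounded fun m => t' m ^ c + c :=
    IsPBounded.comp_holds (s := fun N => N ^ c + c) ⟨c, fun N => le_rfl⟩ ⟨a + 1, ht'le⟩
  -- transport: a circuit for `det_{t' m}` yields one for `IMM_{m, ⌊√log₂ m⌋}`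
  have key : ∀ (m : ℕ) (Γ : ArithCircuit K (Fin (t' m) × Fin (t' m))),
      Γ.Computes (detPoly (Fin (t' m)) K) →
      ∃ D : ArithCircuit K (Fin (Nat.sqrt (Nat.log 2 m)) × Fin m × Fin m),
        D.Computes (immPoly m (Nat.sqrt (Nat.log 2 m)) K) ∧ D.productDepth ≤ Γ.productDepth ∧
          D.edgeSize ≤ Γ.edgeSize := by
    intro m Γ hΓ
    have hproj' : IsProjection (immPoly m (Nat.sqrt (Nat.log 2 m)) K) (detPoly (Fin (t' m)) K) :=
      IsProjection.trans_holds (hproj m)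
        (isProjection_detPoly_of_le K (by rw [ht']; exact le_max_left _ _))
    obtain ⟨D, hDc, hDd, hDe, -⟩ := exists_circuit_of_isProjectionK hproj' Γ hΓ
    exact ⟨D, hDc, hDd, hDe⟩
  -- constants: exponent / depth slack, hardness threshold `m₁`, tower point `m = 2^2^2^Y`
  obtain ⟨m₁, hm₁⟩ := immHard_anyField K hpq (b + p + K₀ + 2)
  obtain ⟨Y, hYa, hYm⟩ : ∃ Y : ℕ, a + 2 ≤ 2 ^ Y ∧ m₁ ≤ Y := by
    refine ⟨a + m₁ + 2, ?_, by omega⟩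
    have : a + m₁ + 2 < 2 ^ (a + m₁ + 2) := Nat.lt_two_pow_self
    omega
  obtain ⟨m, hm⟩ : ∃ m : ℕ, m = 2 ^ (2 ^ (2 ^ Y)) := ⟨_, rfl⟩
  have hYle : Y ≤ m := by
    have h1 : Y < 2 ^ Y := Nat.lt_two_pow_self
    have h2 : 2 ^ Y < 2 ^ (2 ^ Y) := Nat.pow_lt_pow_right (by norm_num) h1
    have h3 : 2 ^ (2 ^ Y) < 2 ^ (2 ^ (2 ^ Y)) := Nat.pow_lt_pow_right (by norm_num) h2
    omega
  have hm1 : 1 ≤ m := hm ▸ Nat.one_le_two_pow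
  obtain ⟨Γ, hΓ, hdepth, hle⟩ := hC (t' m)
  obtain ⟨D, hDc, hDd, hDe⟩ := key m Γ hΓ
  have hL3m : Nat.log 2 (Nat.log 2 (Nat.log 2 m)) = Y := hm ▸ log3_tower Y
  have hL3n : Nat.log 2 (Nat.log 2 (Nat.log 2 (t' m))) ≤ Y + 1 :=
    log3_le_of_le_tower_pow Y (a + 1) (t' m) hYa (hm ▸ ht'le m)
  have hdepthD : D.productDepth ≤
      p * Nat.log 2 (Nat.log 2 (Nat.log 2 m)) / q + (b + p + K₀ + 2) := by
    rw [hL3m]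
    have hslack := mul_succ_div_le p Y q
    calc D.productDepth ≤ Γ.productDepth := hDd
      _ ≤ p * Nat.log 2 (Nat.log 2 (Nat.log 2 (t' m))) / q + K₀ := hdepth
      _ ≤ p * (Y + 1) / q + K₀ :=
          Nat.add_le_add_right (Nat.div_le_div_right (Nat.mul_le_mul_left _ hL3n)) _
      _ ≤ p * Y / q + (b + p + K₀ + 2) := by omega
  have hlt := hm₁ m (by omega) D hDc hdepthD
  have hsize : D.edgeSize ≤ m ^ b + b := hDe.trans (hle.trans (hb m))
  have hmono : m ^ b + b ≤ m ^ (b + p + K₀ + 2) + (b + p + K₀ + 2) :=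
    Nat.add_le_add (Nat.pow_le_pow_right hm1 (by omega)) (by omega)
  omega

/-! ### The `𝔽̄₂` leaf of W34 and `D_int(2, ·)`, below slope `1/2` -/

/-- **The VP-internal LEAF of W34, DECIDED below slope `1/2`**: the determinant has no `∃ c ∀ n`
family of `(n^c + c)`-wire circuits of product depth `⌊p·L₃(n)/q⌋ + K₀` over `𝔽̄₂`, for every
`p/q < 1/2` (the route budget is slope `1`: `L₃(n) + 1`). [cite: Forbes2024LowDepth, Cor. 2] -/
theorem not_detEasyOver_algClosure_two_of_lt {p q : ℕ} (hpq : 2 * p < q) (K₀ : ℕ) :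
    ¬ DetEasyOver (AlgebraicClosure (ZMod 2)) (fun n => p * Nat.log 2 (Nat.log 2 (Nat.log 2 n)) / q + K₀) :=
  not_detEasyOver_anyField _ hpq K₀

/-- The permanent form of the leaf over every field of characteristic `2`. [cite: Forbes2024LowDepth, Cor. 2] -/
theorem not_perEasyOver_of_charTwo_of_lt (K : Type) [Field K] [CharP K 2] {p q : ℕ} (hpq : 2 * p < q)
    (K₀ : ℕ) : ¬ PerEasyOver K (fun n => p * Nat.log 2 (Nat.log 2 (Nat.log 2 n)) / q + K₀) := fun h =>
  not_detEasyOver_anyField K hpq K₀ ((perEasyOver_iff_detEasyOver_of_charTwo K _).mp h)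

/-- **`D_int(2, ⌊σ L₃⌋ + K₀)` HOLDS for every `σ < 1/2`**: the permanent is hard at that budget over
every `2`-non-unit constant ring (all subrings of `ℚ̄ ∩ ℤ̄`, `ℤ[ω]`, `ℤ[ζ₇]`, the inert notch …),
unconditionally. [cite: Forbes2024LowDepth, Cor. 2] [cite: Burgisser2000, §4.1] -/
theorem nonUnitHardAt_two_of_lt {p q : ℕ} (hpq : 2 * p < q) (K₀ : ℕ) :
    NonUnitHardAt 2 (fun n => p * Nat.log 2 (Nat.log 2 (Nat.log 2 n)) / q + K₀) :=
  nonUnitHardAt_two_of_not_detEasyOver_algClosure _ (not_detEasyOver_algClosure_two_of_lt hpq K₀)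

/-! ### The permanent over EVERY field, and `D_int(p, ·)` for every prime `p`, below slope `1/2` -/

/-- **The PERMANENT is hard at product depth `⌊σ·log₂log₂log₂ n⌋ + K₀` over EVERY field, `σ < 1/2`.**
Characteristic `2`: `per = det` (`not_perEasyOver_of_charTwo_of_lt`).  Characteristic `≠ 2`: the
`VNP`-completeness of the permanent over `K` (Valiant 1979; the tree's
`isVNPComplete_perPoly_holds`, tagged BCS Thm. (21.17)) makes `IMM_{m,⌊√log₂ m⌋}` a
projection of `per_{t m}`, and the tower bookkeeping of `DefinabilityGapK1DepthLadder.perHard_io_log3`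
runs verbatim over `K` with `immHard_anyField` as the engine.
[cite: Forbes2024LowDepth, Cor. 2] [cite: Valiant1979] [cite: Burgisser2000, Ch. 2] -/
theorem not_perEasyOver_anyField (K : Type) [Field K] {p q : ℕ} (hpq : 2 * p < q) (K₀ : ℕ) :
    ¬ PerEasyOver K (fun n => p * Nat.log 2 (Nat.log 2 (Nat.log 2 n)) / q + K₀) := by
  classical
  by_cases hchar : ringChar K = 2
  · haveI : CharP K 2 := ringChar.of_eq hchar
    exact not_perEasyOver_of_charTwo_of_lt K hpq K₀
  rintro ⟨c, hC⟩
  let dd : ℕ → ℕ := fun m => Nat.sqrt (Nat.log 2 m)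
  have hdd_le : ∀ m, dd m ≤ m := fun m => (Nat.sqrt_le_self _).trans (Nat.log_le_self 2 m)
  let v : ℕ → ℕ := fun m => Fintype.card (Fin (dd m) × Fin m × Fin m)
  let e : ∀ m, (Fin (dd m) × Fin m × Fin m) ≃ Fin (v m) := fun m => Fintype.equivFin _
  let G : ∀ m, MvPolynomial (Fin (dd m) × Fin m × Fin m) K := fun m => immPoly m (dd m) K
  let G' : ∀ m, MvPolynomial (Fin (v m)) K := fun m => renameEquiv K (e m) (G m)
  have hv : ∀ m, Fintype.card (Fin (dd m) × Fin m × Fin m) ≤ m ^ 3 + 3 := card_immVars_le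
  have hG : IsVPFamily G := by
    refine ⟨⟨⟨3, fun m => hv m⟩, ⟨1, fun m => ?_⟩⟩, ⟨6, fun m => ?_⟩⟩
    · show (immPoly m (dd m) K).totalDegree ≤ m ^ 1 + 1
      refine ((immPoly_isHomogeneous_holds (k := K) m (dd m)).totalDegree_le).trans ?_
      rw [pow_one]; exact (hdd_le m).trans (Nat.le_succ m)
    · show complexity (immPoly m (dd m) K) ≤ m ^ 6 + 6
      calc complexity (immPoly m (dd m) K) ≤ m + 2 * m ^ 3 * dd m := complexity_immPoly_le K m (dd m)
        _ ≤ m ^ 1 + 2 * (m ^ 1) ^ 3 * m := by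
            rw [pow_one]; exact Nat.add_le_add_left (Nat.mul_le_mul_left _ (hdd_le m)) _
        _ ≤ m ^ (3 * 1 + 3) + (3 * 1 + 3) := imm_cost_le 1 m
        _ = m ^ 6 + 6 := by norm_num
  have hG' : IsVPFamily G' := (isVPFamily_renameEquiv_iff e G).2 hG
  have hG'N : IsVNPFamily G' := IsVPFamily.isVNPFamily_holds' hG'
  obtain ⟨t, ht, hproj⟩ := (isVNPComplete_perPoly_holds K hchar).2 v G' hG'N
  obtain ⟨a, ha⟩ := ht
  obtain ⟨t', ht'⟩ : ∃ t' : ℕ → ℕ, ∀ m, t' m = max (t m) m := ⟨_, fun _ => rfl⟩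
  have ht'le : ∀ m, t' m ≤ m ^ (a + 1) + (a + 1) := fun m => by
    rw [ht']
    refine max_le ((ha m).trans ?_) ?_
    · rcases Nat.eq_zero_or_pos m with rfl | hm
      · rcases Nat.eq_zero_or_pos a with rfl | hapos
        · simp
        · rw [zero_pow hapos.ne', zero_pow (by omega)]; omega
      · exact Nat.add_le_add (Nat.pow_le_pow_right hm (Nat.le_succ a)) (Nat.le_succ a)
    · calc m = m ^ 1 := (pow_one m).symm
        _ ≤ m ^ (a + 1) := by
            rcases Nat.eq_zero_or_pos m with rfl | hm
            · simp
            · exact Nat.pow_le_pow_right hm (by omega)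
        _ ≤ m ^ (a + 1) + (a + 1) := Nat.le_add_right _ _
  obtain ⟨b, hb⟩ : IsPBounded fun m => t' m ^ c + c :=
    IsPBounded.comp_holds (s := fun N => N ^ c + c) ⟨c, fun N => le_rfl⟩ ⟨a + 1, ht'le⟩
  -- transport: a circuit for `per_{t' m}` yields one for `IMM_{m, dd m}`, same depth, no more wires
  have key : ∀ (m : ℕ) (Γ : ArithCircuit K (Fin (t' m) × Fin (t' m))), Γ.Computes (perPoly (Fin (t' m)) K) →
      ∃ D : ArithCircuit K (Fin (dd m) × Fin m × Fin m),
        D.Computes (G m) ∧ D.productDepth ≤ Γ.productDepth ∧ D.edgeSize ≤ Γ.edgeSize := by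
    intro m Γ hΓ
    have hproj' : IsProjection (G' m) (perPoly (Fin (t' m)) K) :=
      IsProjection.trans_holds (hproj m) (isProjection_perPoly_of_le K (by rw [ht']; exact le_max_left _ _))
    obtain ⟨D', hD'c, hD'd, hD'e, -⟩ := exists_circuit_of_isProjectionK hproj' Γ hΓ
    have hGm : MvPolynomial.rename (e m).symm (G' m) = G m := by
      show MvPolynomial.rename (e m).symm (renameEquiv K (e m) (G m)) = G m
      rw [renameEquiv_apply, rename_rename, (e m).symm_comp_self, rename_id_apply]
    refine ⟨D'.rename (e m).symm, ?_, ?_, ?_⟩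
    · rw [ArithCircuit.Computes, ← hGm]; exact hD'c.rename (e m).symm
    · exact (DepthThreeChasm.productDepth_rename _ _).le.trans hD'd
    · exact (DepthThreeChasm.edgeSize_rename _ _).le.trans hD'e
  obtain ⟨m₁, hm₁⟩ := immHard_anyField K hpq (b + p + K₀ + 2)
  obtain ⟨Y, hYa, hYm⟩ : ∃ Y : ℕ, a + 2 ≤ 2 ^ Y ∧ m₁ ≤ Y := by
    refine ⟨a + m₁ + 2, ?_, by omega⟩
    have : a + m₁ + 2 < 2 ^ (a + m₁ + 2) := Nat.lt_two_pow_self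
    omega
  obtain ⟨m, hm⟩ : ∃ m : ℕ, m = 2 ^ (2 ^ (2 ^ Y)) := ⟨_, rfl⟩
  have hYle : Y ≤ m := by
    have h1 : Y < 2 ^ Y := Nat.lt_two_pow_self
    have h2 : 2 ^ Y < 2 ^ (2 ^ Y) := Nat.pow_lt_pow_right (by norm_num) h1
    have h3 : 2 ^ (2 ^ Y) < 2 ^ (2 ^ (2 ^ Y)) := Nat.pow_lt_pow_right (by norm_num) h2
    omega
  have hm1 : 1 ≤ m := hm ▸ Nat.one_le_two_pow
  obtain ⟨Γ, hΓ, hdepth, hle⟩ := hC (t' m)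
  obtain ⟨D, hDc, hDd, hDe⟩ := key m Γ hΓ
  have hL3m : Nat.log 2 (Nat.log 2 (Nat.log 2 m)) = Y := hm ▸ log3_tower Y
  have hL3n : Nat.log 2 (Nat.log 2 (Nat.log 2 (t' m))) ≤ Y + 1 :=
    log3_le_of_le_tower_pow Y (a + 1) (t' m) hYa (hm ▸ ht'le m)
  have hdepthD : D.productDepth ≤
      p * Nat.log 2 (Nat.log 2 (Nat.log 2 m)) / q + (b + p + K₀ + 2) := by
    rw [hL3m]
    have hslack := mul_succ_div_le p Y q
    calc D.productDepth ≤ Γ.productDepth := hDd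
      _ ≤ p * Nat.log 2 (Nat.log 2 (Nat.log 2 (t' m))) / q + K₀ := hdepth
      _ ≤ p * (Y + 1) / q + K₀ :=
          Nat.add_le_add_right (Nat.div_le_div_right (Nat.mul_le_mul_left _ hL3n)) _
      _ ≤ p * Y / q + (b + p + K₀ + 2) := by omega
  have hlt := hm₁ m (by omega) D hDc hdepthD
  have hsize : D.edgeSize ≤ m ^ b + b := hDe.trans (hle.trans (hb m))
  have hmono : m ^ b + b ≤ m ^ (b + p + K₀ + 2) + (b + p + K₀ + 2) :=
    Nat.add_le_add (Nat.pow_le_pow_right hm1 (by omega)) (by omega)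
  omega

/-- **`D_int(p, ⌊σ L₃⌋ + K₀)` for EVERY prime `p` and every `σ < 1/2`**: the permanent is hard at that
budget over every constant ring in which `p` is not a unit (from the leaf over `𝔽̄_p`).
[cite: Forbes2024LowDepth, Cor. 2] [cite: Burgisser2000, §4.1] -/
theorem nonUnitHardAt_of_lt (r : ℕ) [Fact r.Prime] {p q : ℕ} (hpq : 2 * p < q) (K₀ : ℕ) :
    NonUnitHardAt r (fun n => p * Nat.log 2 (Nat.log 2 (Nat.log 2 n)) / q + K₀) :=
  nonUnitHardAt_of_not_perEasyOver_algClosure _ (not_perEasyOver_anyField (AlgebraicClosure (ZMod r)) hpq K₀)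

end Summit.ValiantsHypothesis.ValiantsHypothesis.Theorems.SuccinctLiftSmlAnyFieldDet
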